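import Summits.QuantumFields.YangMills.Theorems.FlatTubeReductionRecordWindowSixth
import Summits.QuantumFields.YangMills.Theorems.LuscherReductionRunningReductionCoarseUpperScalesTwo
import Summits.QuantumFields.YangMills.Theorems.LuscherReductionOneSiteLevelsValleyReduction
import Summits.QuantumFields.YangMills.Theorems.FemtoTransferGapOneSiteScaling
import Summits.QuantumFields.YangMills.Theorems.TwistedTraceScaling.Negative.ModelPerturbedNearRigidity
import Summits.QuantumFields.YangMills.Theorems.TwistedTraceScaling.Negative.SupportRecordRadiusThree
import HarnessLib

/-!
# Record-scale numerology for the (N)-POINTWISE brick: core radius `r = β^{-7/8}`, gauge width `s = β^{-1}`, tube radius `δ = (42D+1)β^{-1/6}`, profile radius `R² ≤ β^{-1}` — the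
# Gaussian tail `4^{d/2}e^{−cβ^{1/4}/4} ≤ r`, the scale orderings, the window inequality `|Edge|(4R + δ₁) < δ`, and `ε_N = O(λ_b²)`
# (route `FlatTubeReduction`, crux K1 `NearFlatRatioLaw` stmt-QuantumFields-24720; seat `ym-line-ftr-p1` g14; rate twin «ratepack-v3 / frozen fibres»; R2b1 RECORD rung — no summit
# statement is proved here)

WHY (memo `Cruxes/NearFlatRatioLaw/Lines/ratepack-v3-frozen-g12.md` §8.2).  `fibreMass_pointwise_eventually` (F9e) is stated for abstract scales `δ → 0`, `0 < δg ≤ δ`, `0 ≤ r ≤ δ²` with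
tail `4^{d/2}e^{−c²r²/4δg²} ≤ r`, a profile radius `R` and a window `δ₁` with `|Edge|(4R + δ₁) < δ`; its error is `4C·orbitDist² + (4C(r + δg²) + 96C·R²)`.  At the record scales of
`AnalyticRatePotInput` (`recordChi L (1/6) (42D+1) M`: `δ = (42D+1)β^{-1/6}`, `δg = β^{-1}`; window `D·recordDelta1`; profile radius with `12|Site|R < β^{-1/6}`, `R² ≤ β^{-1}`) and
`r = β^{-7/8}` every hypothesis holds eventually and the slack is `≤ 104C·L²·λ_b(L³β)²`.
* `eventually_mul_exp_neg_rpow_quarter_le`, `record_tail_eventually`, `record_scales_le`, `record_window_lt` (with the disprover's `R21.powScale_sq`, `R36.card_edge_eq`),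
  `powScale_le_sq_bareLambda`, `record_epsN_small`.
HONEST FRAMING: real-analysis numerology; femto rung R2b1 (RECORD label); not infinite volume, not a gap, not Clay.  No defs, no named facts, no `sorry`.
-/

set_option autoImplicit false

noncomputable section

open MeasureTheory Filter Topology Real
open scoped BigOperators
open Literature.MathematicalPhysics.QuantumFieldTheory
open Literature.MathematicalPhysics.QuantumLattice

namespace Summit.QuantumFields.YangMills.Theorems.FemtoTransferGap.TwoLattice.ConstTube

open Summit.QuantumFields.YangMills.Theorems.FemtoTransferGap
open Summit.QuantumFields.YangMills.Theorems.TwistedTraceScaling.Negative.R21 (powScale_sq)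
open Summit.QuantumFields.YangMills.Theorems.TwistedTraceScaling.Negative.R36 (card_edge_eq)

variable {L : ℕ} [NeZero L]

/-! ## §1 The Gaussian tail at `r/s = β^{1/8}` -/

omit [NeZero L] in
/-- `A·e^{−aβ^{1/4}} ≤ β^{-7/8}` eventually (`A ≥ 0`, `a > 0`). [folklore] -/
theorem eventually_mul_exp_neg_rpow_quarter_le {A a : ℝ} (hA : 0 ≤ A) (ha : 0 < a) :
    ∀ᶠ β : ℝ in atTop, A * Real.exp (-(a * β ^ ((1 : ℝ) / 4))) ≤ β ^ (-((7 : ℝ) / 8)) := by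
  have hx : Tendsto (fun β : ℝ => a * β ^ ((1 : ℝ) / 4)) atTop atTop := (tendsto_rpow_atTop (by norm_num : (0 : ℝ) < 1 / 4)).const_mul_atTop ha
  have hφ := (Real.tendsto_pow_mul_exp_neg_atTop_nhds_zero 4).comp hx
  have hev : ∀ᶠ β : ℝ in atTop, (a * β ^ ((1 : ℝ) / 4)) ^ 4 * Real.exp (-(a * β ^ ((1 : ℝ) / 4))) ≤ a ^ 4 / (A + 1) :=
    hφ.eventually (eventually_le_nhds (by positivity))
  filter_upwards [hev, Filter.eventually_ge_atTop (1 : ℝ)] with β h hβ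
  have hβ0 : 0 < β := by linarith
  have h4 : (β ^ ((1 : ℝ) / 4)) ^ 4 = β := by
    rw [← Real.rpow_natCast (β ^ ((1 : ℝ) / 4)) 4, ← Real.rpow_mul hβ0.le]; norm_num
  rw [mul_pow, h4] at h
  -- `a⁴ β e^{-x} ≤ a⁴/(A+1)` ⇒ `A e^{-x} ≤ A/((A+1)β) ≤ β^{-1} ≤ β^{-7/8}`
  have ha4 : 0 < a ^ 4 := by positivity
  have hE := Real.exp_pos (-(a * β ^ ((1 : ℝ) / 4)))
  have h1 : β * Real.exp (-(a * β ^ ((1 : ℝ) / 4))) ≤ 1 / (A + 1) := by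
    have : a ^ 4 * (β * Real.exp (-(a * β ^ ((1 : ℝ) / 4)))) ≤ a ^ 4 * (1 / (A + 1)) := by rw [mul_one_div]; linarith only [h]
    exact le_of_mul_le_mul_left this ha4
  have h2 : A * Real.exp (-(a * β ^ ((1 : ℝ) / 4))) * β ≤ 1 := by
    have hA1 : A * (1 / (A + 1)) ≤ 1 := by rw [mul_one_div, div_le_one (by linarith)]; linarith
    calc A * Real.exp (-(a * β ^ ((1 : ℝ) / 4))) * β = A * (β * Real.exp (-(a * β ^ ((1 : ℝ) / 4)))) := by ring
      _ ≤ A * (1 / (A + 1)) := mul_le_mul_of_nonneg_left h1 hA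
      _ ≤ 1 := hA1
  have h3 : A * Real.exp (-(a * β ^ ((1 : ℝ) / 4))) ≤ β ^ (-(1 : ℝ)) := by
    rw [Real.rpow_neg_one, ← one_div, le_div_iff₀ hβ0]; exact h2
  exact h3.trans (Real.rpow_le_rpow_of_exponent_le hβ (by norm_num))

omit [NeZero L] in
/-- ★ **The record tail**: `A·exp(−c·(β^{-7/8})²/(4(β^{-1})²)) ≤ β^{-7/8}` eventually (`A ≥ 0`, `c > 0`; the exponent is `(c/4)β^{1/4}`). [folklore] -/
theorem record_tail_eventually {A c : ℝ} (hA : 0 ≤ A) (hc : 0 < c) :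
    ∀ᶠ β : ℝ in atTop, A * Real.exp (-(c * powScale (7 / 8) β ^ 2 / (4 * powScale 1 β ^ 2))) ≤ powScale (7 / 8) β := by
  filter_upwards [eventually_mul_exp_neg_rpow_quarter_le hA (by positivity : 0 < c / 4), Filter.eventually_ge_atTop (1 : ℝ)] with β h hβ
  have hβ0 : 0 < β := by linarith
  have he : c * powScale (7 / 8) β ^ 2 / (4 * powScale 1 β ^ 2) = c / 4 * β ^ ((1 : ℝ) / 4) := by
    rw [powScale_sq, powScale_sq, powScale_eq hβ, powScale_eq hβ]
    have h1 : β ^ (-(2 * (7 / 8 : ℝ))) / β ^ (-(2 * (1 : ℝ))) = β ^ ((1 : ℝ) / 4) := by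
      rw [← Real.rpow_sub hβ0]; norm_num
    have hne : β ^ (-(2 * (1 : ℝ))) ≠ 0 := (Real.rpow_pos_of_pos hβ0 _).ne'
    field_simp
    rw [div_eq_iff hne] at h1
    linarith [h1]
  rw [he, powScale_eq hβ]; exact h

/-! ## §2 Scale orderings and the window -/

omit [NeZero L] in
/-- `0 < β^{-1} ≤ Kβ^{-1/6}` and `0 ≤ β^{-7/8} ≤ (Kβ^{-1/6})²` for `K ≥ 1` (all `β`). [folklore] -/
theorem record_scales_le {K : ℝ} (hK : 1 ≤ K) (β : ℝ) :
    (0 < powScale 1 β ∧ powScale 1 β ≤ K * powScale (1 / 6) β) ∧ (0 ≤ powScale (7 / 8) β ∧ powScale (7 / 8) β ≤ (K * powScale (1 / 6) β) ^ 2) := by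
  have h16 := powScale_pos (1 / 6) β
  refine ⟨⟨powScale_pos 1 β, ?_⟩, (powScale_pos _ β).le, ?_⟩
  · have h := powScale_le_powScale (show (1 / 6 : ℝ) ≤ 1 by norm_num) β
    nlinarith
  · have h := powScale_le_powScale (show (2 * (1 / 6) : ℝ) ≤ 7 / 8 by norm_num) β
    rw [← powScale_sq] at h
    have : powScale (1 / 6) β ^ 2 ≤ (K * powScale (1 / 6) β) ^ 2 := by
      rw [mul_pow]; nlinarith [sq_nonneg (powScale (1 / 6) β), show (1 : ℝ) ≤ K ^ 2 by nlinarith]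
    exact h.trans this

/-- ★ **The window inequality**: `12|Site|·R < β^{-1/6}`, `D ≥ 0` ⇒ `0 ≤ D·recordDelta1 β` and `|Edge|·(4R + D·recordDelta1 β) < (42D+1)β^{-1/6}`. [folklore] -/
theorem record_window_lt {D R β : ℝ} (hD : 0 ≤ D) (hR : 12 * Fintype.card (Site 3 L) * R < powScale (1 / 6) β) :
    0 ≤ D * recordDelta1 L (1 / 6) β ∧ Fintype.card (Edge 3 L) * (4 * R + D * recordDelta1 L (1 / 6) β) < (42 * D + 1) * powScale (1 / 6) β := by
  have hN := card_site_pos (L := L)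
  have hps := powScale_pos (1 / 6) β
  refine ⟨mul_nonneg hD (by unfold recordDelta1; positivity), ?_⟩
  rw [card_edge_eq]
  unfold recordDelta1
  have e : 3 * (Fintype.card (Site 3 L) : ℝ) * (4 * R + D * (14 * powScale (1 / 6) β / Fintype.card (Site 3 L))) =
      12 * Fintype.card (Site 3 L) * R + 42 * D * powScale (1 / 6) β := by
    field_simp; ring
  rw [e]; linarith

/-! ## §3 The slack is `O(λ_b²)` -/

/-- `β^{-p} ≤ L²·λ_b(L³β)²` for `β ≥ 1`, `p ≥ 3/4` (`λ_b(L³β) = (2/β)^{1/3}/L ≥ β^{-1/3}/L`). [folklore] -/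
theorem powScale_le_sq_bareLambda {p β : ℝ} (hβ : 1 ≤ β) (hp : 3 / 4 ≤ p) : powScale p β ≤ (L : ℝ) ^ 2 * bareLambda ((L : ℝ) ^ 3 * β) ^ 2 := by
  have hβ0 : 0 < β := by linarith
  have hL0 : (0 : ℝ) < L := by exact_mod_cast Nat.pos_of_ne_zero (NeZero.ne L)
  rw [powScale_eq hβ, bareLambda_cube_mul hβ0 L, div_pow, mul_div_cancel₀ _ (by positivity), bareLambda_eq_rpow hβ0]
  have h2 : (1 : ℝ) ≤ (2 : ℝ) ^ ((1 : ℝ) / 3) := Real.one_le_rpow (by norm_num) (by norm_num)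
  have hb0 : 0 ≤ β ^ (-(1 : ℝ) / 3) := (Real.rpow_pos_of_pos hβ0 _).le
  have hge : β ^ (-(1 : ℝ) / 3) ≤ (2 : ℝ) ^ ((1 : ℝ) / 3) * β ^ (-(1 : ℝ) / 3) := by nlinarith
  have hsq : (β ^ (-(1 : ℝ) / 3)) ^ 2 = β ^ (-((2 : ℝ) / 3)) := by
    rw [← Real.rpow_natCast (β ^ (-(1 : ℝ) / 3)) 2, ← Real.rpow_mul hβ0.le]; norm_num
  have hmono : β ^ (-p) ≤ β ^ (-((2 : ℝ) / 3)) := Real.rpow_le_rpow_of_exponent_le hβ (by linarith)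
  calc β ^ (-p) ≤ β ^ (-((2 : ℝ) / 3)) := hmono
    _ = (β ^ (-(1 : ℝ) / 3)) ^ 2 := hsq.symm
    _ ≤ ((2 : ℝ) ^ ((1 : ℝ) / 3) * β ^ (-(1 : ℝ) / 3)) ^ 2 := pow_le_pow_left₀ hb0 hge 2

/-- ★ **`ε_N = O(λ_b²)`**: with `R² ≤ β^{-1}` eventually, `4C(β^{-7/8} + (β^{-1})²) + 96C·R² ≤ 104C·L²·λ_b(L³β)²` eventually (`C ≥ 0`). [folklore] -/
theorem record_epsN_small {C : ℝ} (hC : 0 ≤ C) {R : ℝ → ℝ} (hR1 : ∀ᶠ β in atTop, R β ^ 2 ≤ powScale 1 β) :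
    ∀ᶠ β : ℝ in atTop, 4 * C * (powScale (7 / 8) β + powScale 1 β ^ 2) + 96 * C * R β ^ 2 ≤ 104 * C * (L : ℝ) ^ 2 * bareLambda ((L : ℝ) ^ 3 * β) ^ 2 := by
  filter_upwards [hR1, Filter.eventually_ge_atTop (1 : ℝ)] with β hRβ hβ
  have h78 := powScale_le_sq_bareLambda (L := L) hβ (show (3 : ℝ) / 4 ≤ 7 / 8 by norm_num)
  have h1 := powScale_le_sq_bareLambda (L := L) hβ (show (3 : ℝ) / 4 ≤ 1 by norm_num)
  have hs2 : powScale 1 β ^ 2 ≤ powScale 1 β := by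
    have := powScale_le_one (show (0 : ℝ) ≤ 1 by norm_num) β; have h0 := (powScale_pos 1 β).le; nlinarith
  nlinarith [hRβ, hs2, h78, h1, hC]

end Summit.QuantumFields.YangMills.Theorems.FemtoTransferGap.TwoLattice.ConstTube

end
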